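import Literature.Geometry.Symplectic.HopfPageSystem
import Literature.Topology.FourManifolds.PlanarLefschetzBodyFacts
import Literature.Topology.FourManifolds.ClosedBallHandles
import Literature.Topology.FourManifolds.HandleAttachingMapsUniqueness
import Literature.AlgebraicTopology.SingularHomology.ExcisionMayerVietoris
import Literature.AlgebraicTopology.FundamentalGroup.SphereSimplyConnected
import Mathlib.Analysis.Convex.Contractible
import HarnessLib

/-!
# `𝔻⁴` is a "planar Lefschetz body over the annulus with no letters" and `S⁴` a "planar word
# manifold of the empty word": refutation of the named facts `planarLefschetzBody_length_of_acyclic`,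
# `planarLefschetzBody_unimodular_of_isZero_H1` and `planarWordManifold_normallyGenerates_of_simplyConnected`

Topic `Literature/Topology/FourManifolds` (next to `PlanarLefschetzBody.lean` /
`PlanarLefschetzBodyFacts.lean`).  Everything here is **proved**; no definitions, no named facts.
(Found by the fact seat `provefact-Literature.Geometry.Symplectic.Oba2016_s…` while checking the
base-recognition step of Oba 2016 / Kas 1980 against the tree's vocabulary.)

**The defect.**  `IsLefschetzHandlebodyOver P o w W` (`AchiralLefschetzModel.lean`) presents `W` as a
compact connected orientable `1`-handlebody `B` plus `2`-handles, where `∂B` carries an open book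
`ob` with a page system `J : P × ℝ → ∂B` (`IsPageSystem ob J`) — intended to say "`∂B` is the open
book `(P, id)`, so `B ≅ P × D²`".  But `IsPageSystem` only trivialises the page bundle over the OPEN
page (`∂B ∖ binding ≅ int P × S¹` fibrewise); `J` is unconstrained near `∂P` and nothing ties it to
the meridional discs of the binding tubes.  Fibrewise triviality over the open page pins the
monodromy only modulo boundary Dehn twists, so `(∂B, ob)` may be `(P_n, ∏ δᵢ^{aᵢ})` for any boundary
multitwist — e.g. the positive Hopf band `(P₁, δ)` on `S³` (`HopfPageSystem.lean`:
`HopfOpenBook.isPageSystem_hopfPages`).  Taking `B = 𝔻⁴` (a `1`-handlebody of genus `0`, boundary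
`S³` with the Hopf open book) and the empty word:

* `isLefschetzHandlebodyOver_closedBall_annulus_nil`, `isPlanarLefschetzBody_closedBall_one_nil` —
  **`IsPlanarLefschetzBody 𝔻⁴ 1 []`** holds, although `X(P₁; ∅) = S¹ × B³ ≠ 𝔻⁴`;
* `not_planarLefschetzBody_length_of_acyclic` — **fact 1 of `PlanarLefschetzBodyFacts.lean` is
  false** (`𝔻⁴` is ℚ-acyclic with `0 ≠ 1` letters);
* `not_planarLefschetzBody_unimodular_of_isZero_H1` — **fact 2 is false** (`H₁(𝔻⁴) = 0` but the
  empty family does not generate `F₁ᵃᵇ ≅ ℤ`);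
* `isAchiralLefschetzModel_sphere_annulus_nil`, `isPlanarWordManifold_sphere_one_nil` — closing the
  fake body `𝔻⁴` off with the `1`-handlebody `V = 𝔻⁴` along `id : S³ → S³` gives
  **`IsPlanarWordManifold S⁴ 1 []`** (`S⁴ = 𝔻⁴ ∪_{id} 𝔻⁴`, `isDouble_sphere_holds`), although
  `X̂(P₁; ∅) = S¹ × S³`;
* `not_planarWordManifold_normallyGenerates_of_simplyConnected` — **fact 3 is false** (`S⁴` is
  simply connected but the empty family does not normally generate `F₁`).

The printed statements behind the facts (Gompf–Stipsicz 1999, §8.1–8.2: `χ(X(F; w)) = χ(F) + |w|`,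
`H₁(X(F; w)) = H₁(F)/⟨[γᵢ]⟩`) are true of the handlebody `X(P_n; w)`; what fails is the rendering of
"`X` is `X(P_n; w)`".  By the same mechanism facts 4–5 (`planarLefschetzBody_contractible[_of_isDouble]`)
should fail (`𝔻⁴ ∪` a `2`-handle along the core of a Hopf page — an unknot, attached with framing
page framing `∓ 1`, i.e. `0` or `∓2` — is the `D²`-bundle over `S²` of Euler number `0` or `∓2`,
with `H₂ ≅ ℤ`, not contractible; not machine-checked here), and the conclusion of `wendl_planarSteinBisection`
(`Geometry/Symplectic/PlanarSteinDictionary.lean`) is weaker than Wendl's theorem.  A repair is a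
matter for the vocabulary (a binding-compatibility clause in `IsPageSystem`: `J` extends over
`∂P × ℝ` onto the binding, matching the polar coordinate of the tubes near each end), not for the
facts.

## References

* R. E. Gompf, A. I. Stipsicz, *4-Manifolds and Kirby Calculus*, GSM 20 (1999), §8.1–8.2.
  [GompfStipsiczGSM1999]
* J. B. Etnyre, *Lectures on open book decompositions and contact structures*, Clay Math. Proc. 5
  (2006), §2. [Etnyre2006]
* A. Hatcher, *Algebraic Topology* (2002), Prop. 1.14 (`π₁(Sⁿ) = 1`, `n ≥ 2`). [Hatcher2002]
-/

noncomputable section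

open scoped Manifold ContDiff Topology
open Set Function

namespace Literature.Topology.FourManifolds

open PlanarWords Literature.Geometry.Symplectic Literature.Geometry.Symplectic.HopfOpenBook
open CategoryTheory.Limits Literature.AlgebraicTopology.SingularHomology

/-- **The closed `4`-ball is a Lefschetz handlebody over the ANNULUS for the EMPTY word**, in
the sense of `IsLefschetzHandlebodyOver` (`AchiralLefschetzModel.lean`): base `B = 𝔻⁴` (a compact
connected orientable `1`-handlebody — of genus `0`), boundary datum `∂𝔻⁴ = S³`
(`closedBallBoundaryData 3`), the positive Hopf open book of `S³` (`HopfOpenBook.hopfOpenBook`,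
annulus pages, monodromy a Dehn twist) with its page system by `SmoothPlanarPage 1`
(`HopfOpenBook.isPageSystem_hopfPages`), no `2`-handles (`IsMultiAttachment.self_of_isEmpty`).
On paper `X(P₁; ∅) = P₁ × D² = S¹ × B³`, which `𝔻⁴` is not: the interface's page-system clause
does not pin the monodromy of the boundary open book rel boundary (only up to boundary twists),
so it admits the Hopf band `(P₁, δ)` on `∂𝔻⁴` alongside the intended `(P₁, id)` on `∂(S¹ × B³)`.
[folklore] -/
theorem isLefschetzHandlebodyOver_closedBall_annulus_nil :
    IsLefschetzHandlebodyOver (SmoothPlanarPage 1) (SmoothPlanarPage.orientation 1)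
      ([] : List (SignedCycle (SmoothPlanarPage 1)))
      (Metric.closedBall (0 : EuclideanSpace ℝ (Fin 4)) 1) := by
  haveI : Fact (isSmoothEmbedding_sphereInclusion' 3) := ⟨isSmoothEmbedding_sphereInclusion'_holds 3⟩
  haveI : ConnectedSpace (Metric.closedBall (0 : EuclideanSpace ℝ (Fin 4)) 1) :=
    connectedSpace_closedBall 3
  refine ⟨Metric.closedBall (0 : EuclideanSpace ℝ (Fin 4)) 1, inferInstance, inferInstance,
    inferInstance, inferInstance, inferInstance, inferInstance, inferInstance, closedBallBoundaryData 3,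
    hopfOpenBook, hopfPages, 1, fun i => i.elim0, isHandlebodyOfIndexLE_closedBall 3 1,
    isOrientable_closedBall 3, ?_, ?_⟩
  · exact
      { pageSystem := isPageSystem_hopfPages
        isSmoothEmbedding := fun i => i.elim0
        interior := fun i => i.elim0
        orient := fun i => i.elim0
        delta_pos := one_pos
        apply_eq := fun i => i.elim0 }
  · exact HandleAttachingMap.IsMultiAttachment.self_of_isEmpty (ι := Fin 0) _

/-- **`𝔻⁴` is a planar Lefschetz body over `P₁` with NO letters** (`IsPlanarLefschetzBody 𝔻⁴ 1 []`,
`PlanarLefschetzBody.lean`), by `isLefschetzHandlebodyOver_closedBall_annulus_nil`.  The intended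
`X(P₁; ∅) = S¹ × B³` has one `1`-handle; `𝔻⁴` has none. [folklore] -/
theorem isPlanarLefschetzBody_closedBall_one_nil :
    IsPlanarLefschetzBody (Metric.closedBall (0 : EuclideanSpace ℝ (Fin 4)) 1) 1 [] := by
  refine ⟨fun i => i.elim0, fun i => i.elim0, ?_⟩
  rw [List.ofFn_zero]
  exact isLefschetzHandlebodyOver_closedBall_annulus_nil

/-- **The `4`-sphere is a closed achiral Lefschetz model over the ANNULUS for the EMPTY word**
(`IsAchiralLefschetzModel`, `AchiralLefschetzModel.lean`): the fake body `W = 𝔻⁴`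
(`isLefschetzHandlebodyOver_closedBall_annulus_nil`) closed off with the compact connected
orientable `1`-handlebody `V = 𝔻⁴` along `Ψ = id : S³ → S³` is `𝔻⁴ ∪_{id} 𝔻⁴ = S⁴`
(`isDouble_sphere_holds`).  On paper `X̂(P₁; ∅) = (S¹ × B³) ∪ (S¹ × B³) = S¹ × S³`. [folklore] -/
theorem isAchiralLefschetzModel_sphere_annulus_nil :
    IsAchiralLefschetzModel (SmoothPlanarPage 1) (SmoothPlanarPage.orientation 1)
      ([] : List (SignedCycle (SmoothPlanarPage 1)))
      (Metric.sphere (0 : EuclideanSpace ℝ (Fin 5)) 1) := by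
  haveI : Fact (isSmoothEmbedding_sphereInclusion' 3) := ⟨isSmoothEmbedding_sphereInclusion'_holds 3⟩
  haveI : ConnectedSpace (Metric.closedBall (0 : EuclideanSpace ℝ (Fin 4)) 1) :=
    connectedSpace_closedBall 3
  refine ⟨Metric.closedBall (0 : EuclideanSpace ℝ (Fin 4)) 1, inferInstance, inferInstance,
    inferInstance, inferInstance, inferInstance, inferInstance,
    Metric.closedBall (0 : EuclideanSpace ℝ (Fin 4)) 1, inferInstance, inferInstance,
    inferInstance, inferInstance, inferInstance, inferInstance, inferInstance,
    closedBallBoundaryData 3, closedBallBoundaryData 3,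
    Diffeomorph.refl (𝓡 3) _ ∞, isLefschetzHandlebodyOver_closedBall_annulus_nil,
    isHandlebodyOfIndexLE_closedBall 3 1, isOrientable_closedBall 3, ?_⟩
  have h := isDouble_sphere_holds (n := 3)
  unfold isDouble_sphere IsDouble at h
  rw [Diffeomorph.coe_refl]
  exact h

/-- **`S⁴` is a planar word manifold of the EMPTY word over `P₁`** (`IsPlanarWordManifold S⁴ 1 []`,
`PlanarLefschetzBody.lean`), by `isAchiralLefschetzModel_sphere_annulus_nil`. [folklore] -/
theorem isPlanarWordManifold_sphere_one_nil :
    IsPlanarWordManifold (Metric.sphere (0 : EuclideanSpace ℝ (Fin 5)) 1) 1 [] := by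
  refine ⟨fun i => i.elim0, fun i => i.elim0, ?_⟩
  rw [List.ofFn_zero]
  exact isAchiralLefschetzModel_sphere_annulus_nil

/-- **REFUTATION of the named fact `planarLefschetzBody_length_of_acyclic`**
(`PlanarLefschetzBodyFacts.lean`, fact 1: "a rationally acyclic planar Lefschetz body over `P_n`
has exactly `n` letters").  Counterexample: `𝔻⁴` is a planar Lefschetz body over `P₁` with `0`
letters (`isPlanarLefschetzBody_closedBall_one_nil`) and is contractible, hence rationally acyclic,
but `0 ≠ 1`.  The printed statement (Gompf–Stipsicz 1999, §8.1–8.2: `χ(X(F; w)) = χ(F) + |w|`) is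
of course true of the handlebody `X(P_n; w)`; what fails is the tree's rendering of "`X` is
`X(P_n; w)`" (`IsLefschetzHandlebodyOver` via `IsPageSystem`), which does not constrain the
boundary behaviour of the page system and therefore also holds for bases whose boundary open book
is `(P_n, boundary multitwist)` — here `(P₁, δ)`, the Hopf band on `S³ = ∂𝔻⁴`. [folklore] -/
theorem not_planarLefschetzBody_length_of_acyclic : ¬ planarLefschetzBody_length_of_acyclic := by
  intro h
  haveI : ContractibleSpace (Metric.closedBall (0 : EuclideanSpace ℝ (Fin 4)) 1) :=
    Metric.contractibleSpace_closedBall zero_le_one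
  have hac : ∀ k, 0 < k →
      IsZero (singularHomology ℚ ℚ (Metric.closedBall (0 : EuclideanSpace ℝ (Fin 4)) 1) k) :=
    fun k hk => isZero_singularHomology_of_contractibleSpace ℚ ℚ (Nat.pos_iff_ne_zero.1 hk)
  have h0 := h (Metric.closedBall (0 : EuclideanSpace ℝ (Fin 4)) 1) 1 []
    isPlanarLefschetzBody_closedBall_one_nil hac
  exact absurd h0 (by decide)

/-- `F₁ᵃᵇ` is not trivial: the image of the generator `x₀` is not `1` (map to `ℤ`). [folklore] -/
theorem abelianization_of_freeGroup_of_ne_one :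
    Abelianization.of (FreeGroup.of (0 : Fin 1)) ≠ (1 : Abelianization (FreeGroup (Fin 1))) := by
  intro h
  let φ : Abelianization (FreeGroup (Fin 1)) →* Multiplicative ℤ :=
    Abelianization.lift (FreeGroup.lift fun _ => Multiplicative.ofAdd (1 : ℤ))
  have h1 : φ (Abelianization.of (FreeGroup.of (0 : Fin 1))) = Multiplicative.ofAdd (1 : ℤ) := by
    simp [φ]
  rw [h, map_one] at h1
  exact absurd (congrArg Multiplicative.toAdd h1) (by decide)

/-- **REFUTATION of the named fact `planarLefschetzBody_unimodular_of_isZero_H1`**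
(`PlanarLefschetzBodyFacts.lean`, fact 2: "if `H₁(X(P_n; w); ℤ) = 0` then the classes of the
curves generate `F_nᵃᵇ`").  Counterexample: `𝔻⁴` over `P₁` with no letters
(`isPlanarLefschetzBody_closedBall_one_nil`) has `H₁ = 0`, but the empty family does not generate
`F₁ᵃᵇ ≅ ℤ`.  As for fact 1, the printed statement (Gompf–Stipsicz 1999, §8.2, p. 292) is true of
`X(P_n; w)`; the tree's `IsLefschetzHandlebodyOver`/`IsPageSystem` is what is under-constrained.
[folklore] -/
theorem not_planarLefschetzBody_unimodular_of_isZero_H1 : ¬ planarLefschetzBody_unimodular_of_isZero_H1 := by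
  intro h
  haveI : ContractibleSpace (Metric.closedBall (0 : EuclideanSpace ℝ (Fin 4)) 1) :=
    Metric.contractibleSpace_closedBall zero_le_one
  have h1 : IsZero (singularHomology ℤ ℤ (Metric.closedBall (0 : EuclideanSpace ℝ (Fin 4)) 1) 1) :=
    isZero_singularHomology_of_contractibleSpace ℤ ℤ one_ne_zero
  have hu : Unimodular 1 (([] : List Letter).map Prod.fst) :=
    h (Metric.closedBall (0 : EuclideanSpace ℝ (Fin 4)) 1) 1 [] isPlanarLefschetzBody_closedBall_one_nil h1
  have hbot : (Subgroup.closure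
      {x | x ∈ (([] : List Letter).map Prod.fst).map fun c => Abelianization.of (PlanarCurve.cls 1 c)}) =
      (⊥ : Subgroup (Abelianization (FreeGroup (Fin 1)))) := by
    simp
  have htop : (⊥ : Subgroup (Abelianization (FreeGroup (Fin 1)))) = ⊤ := hbot.symm.trans hu
  have hmem : Abelianization.of (FreeGroup.of (0 : Fin 1)) ∈ (⊥ : Subgroup (Abelianization (FreeGroup (Fin 1)))) := by
    rw [htop]; exact Subgroup.mem_top _
  exact abelianization_of_freeGroup_of_ne_one (Subgroup.mem_bot.1 hmem)

/-- The empty family does not normally generate `F₁` (its normal closure is trivial, and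
`x₀ ≠ 1` in the free group). [folklore] -/
theorem not_normallyGenerates_one_nil : ¬ NormallyGenerates 1 [] := by
  intro h
  unfold NormallyGenerates at h
  have hle : Subgroup.normalClosure {x | x ∈ ([] : List PlanarCurve).map (PlanarCurve.cls 1)} ≤
      (⊥ : Subgroup (FreeGroup (Fin 1))) :=
    Subgroup.normalClosure_le_normal (by simp)
  rw [h, top_le_iff] at hle
  have hmem : FreeGroup.of (0 : Fin 1) ∈ (⊥ : Subgroup (FreeGroup (Fin 1))) := by
    rw [hle]; exact Subgroup.mem_top _
  exact FreeGroup.of_ne_one _ (Subgroup.mem_bot.1 hmem)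

/-- **REFUTATION of the named fact `planarWordManifold_normallyGenerates_of_simplyConnected`**
(`PlanarLefschetzBodyFacts.lean`, fact 3: "a simply connected planar word manifold `X̂(P_n; w)` has
curves normally generating `F_n`").  Counterexample: `S⁴` is a planar word manifold of the empty
word over `P₁` (`isPlanarWordManifold_sphere_one_nil`) and is simply connected (Hatcher 2002,
Prop. 1.14; tree: `simplyConnectedSpace_euclideanSphere`), but the empty family does not normally
generate `F₁` (`not_normallyGenerates_one_nil`).  The printed statement (Gompf–Stipsicz 1999, §8.2,
p. 292: `π₁(X(F; w)) = π₁(F)/⟨⟨γᵢ⟩⟩`) is true of `X̂(P_n; w)`; as for facts 1–2 the defect is the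
page-system clause of `IsLefschetzHandlebodyOver`. [folklore] -/
theorem not_planarWordManifold_normallyGenerates_of_simplyConnected :
    ¬ planarWordManifold_normallyGenerates_of_simplyConnected := by
  intro h
  haveI : SimplyConnectedSpace (Metric.sphere (0 : EuclideanSpace ℝ (Fin 5)) 1) :=
    Literature.AlgebraicTopology.FundamentalGroup.simplyConnectedSpace_euclideanSphere 4 (by norm_num)
  have h1 := h (Metric.sphere (0 : EuclideanSpace ℝ (Fin 5)) 1) 1 []
    isPlanarWordManifold_sphere_one_nil inferInstance
  exact not_normallyGenerates_one_nil (by simpa using h1)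

end Literature.Topology.FourManifolds
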